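import Summits.BirchSwinnertonDyer.BirchSwinnertonDyer.Theorems.SignedLowerHalvesSmallImageLowerHalfBothSignsLambdaLowerThreeNsThetaPartnerSharpExport
import Summits.BirchSwinnertonDyer.BirchSwinnertonDyer.Theorems.ResidualThetaTransportAtTwoHeckeThetaPartnerAdicAtTwoTeichmullerTwist
import Summits.BirchSwinnertonDyer.BirchSwinnertonDyer.Theorems.ResidualThetaTransportAtTwoHeckeThetaPartnerAdicAtTwoTypeOneGrossencharakter
import Literature.NumberTheory.EllipticCurves.HeckeThetaCMNewformGamma0Holds
import Literature.NumberTheory.EllipticCurves.CMNewformGamma0PrimitiveIsNewform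
import Literature.NumberTheory.GaloisRepresentations.GrossencharakterConductor
import Literature.NumberTheory.Automorphic.BCDTModularity
import Mathlib.GroupTheory.PGroup
import HarnessLib

/-!
# STUB-IDEAS `stub_modThree` · ideator k1 · GENERATION 10 — companion sketch (helper signatures)

Crux `FreyModularity` (stmt-ABC-11340), line `Lines/Sketch.lean`, stub `stub_modThree` (Langlands–Tunnell mod 3, as typed).
This file types the helper lemmas of `STUB-IDEAS-stub_modThree-1.md` (gen 10), PLAN D¹⁰ʙ = TRANSFER THE SOLVED SIBLING:
the 2-group half `TwoGroupBranch` of the stub from the PROVED odd-`p` Hecke-theta-partner bricks of BSD's line `rtt_w3`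
(`…SmallImageLambdaLowerThreeNsThetaPartner.exists_heckeCharacter_teichmuller`, `exists_numberField_of_index_two`,
`HeckeThetaPartner.exists_isGrossencharakter_embType`, `exists_isGrossencharakter_congr`, `nebentypus_of_sharp`), Hecke's theta series
(`HeckeTheta.heckeThetaCuspForm_of_isGrossencharakter`, sorry-free 2026-08-29) and the conductor (`IsGrossencharakter.exists_primitive`),
with ONE residual named fact `shimura1972_heckeTheta_isNewform0_of_primitive` (exact level; the same residual BSD's `stub_citedInputs_rtt` carries).
`sorry` only in helper stubs E0–E5 (+ the restated H0/N1, proved in the gen-2 / gen-6 companions); every composition is kernel-checked.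
-/

set_option autoImplicit false
set_option linter.dupNamespace false
noncomputable section

open scoped Classical NumberField MatrixGroups Polynomial
open IsDedekindDomain IsDedekindDomain.HeightOneSpectrum Field Matrix NumberField WeierstrassCurve Polynomial
open Literature.NumberTheory.EllipticCurves Literature.NumberTheory.EllipticCurves.ModularForms
open Literature.NumberTheory.GaloisRepresentations Literature.NumberTheory.LFunctions
open Literature.NumberTheory.Automorphic Literature.NumberTheory.Automorphic.BCDT

namespace Summit.ABC.ABC.Cruxes.FreyModularity.Sketch.StubModThreeIdeasK1G10

/-! ## The registered stub and its two halves (verbatim from the gen-7 companion) -/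

/-- The registered stub S1a, verbatim. -/
def StubModThree : Prop :=
  ∀ (W : WeierstrassCurve ℚ) [W.IsElliptic] (ρ : ModPGaloisRep ℚ (ZMod 3) 2),
    W.IsTorsionGaloisRep 3 ρ → FramedRep.IsAbsolutelyIrreducible ρ → ρ.IsModular

/-- The surjective (octahedral) half — unchanged road: Langlands–Tunnell, blocked-on the 8 LT leaves (R1). -/
def StubModThreeSurj : Prop :=
  ∀ (W : WeierstrassCurve ℚ) [W.IsElliptic] (ρ : ModPGaloisRep ℚ (ZMod 3) 2),
    W.IsTorsionGaloisRep 3 ρ → Function.Surjective ρ → ρ.IsModular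

/-- The 2-group (normaliser-of-Cartan) half of the stub as typed — the target of PLAN D¹⁰ʙ. -/
def TwoGroupBranch : Prop :=
  ∀ (W : WeierstrassCurve ℚ) [W.IsElliptic] (ρ : ModPGaloisRep ℚ (ZMod 3) 2),
    W.IsTorsionGaloisRep 3 ρ → FramedRep.IsAbsolutelyIrreducible ρ →
    IsPGroup 2 ρ.toMonoidHom.range → ρ.IsModular

/-- **H0** (PROVED, gen-2 companion; restated): `ρ̄_{E,3}` is odd. -/
theorem isOdd_of_isTorsionGaloisRep_three (W : WeierstrassCurve ℚ) [W.IsElliptic]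
    (ρ : ModPGaloisRep ℚ (ZMod 3) 2) (hρ : W.IsTorsionGaloisRep 3 ρ) : FramedGaloisRep.IsOdd ρ := by
  sorry

/-- **N1** (PROVED, gen-6 companion l. 421; restated): irreducible odd `ρ̄ : G_ℚ → GL₂(𝔽₃)` is onto or has 2-group image. -/
theorem surjective_or_isPGroup_two (ρ : ModPGaloisRep ℚ (ZMod 3) 2)
    (hirr : FramedRep.IsIrreducible ρ) (hodd : FramedGaloisRep.IsOdd ρ) :
    Function.Surjective ρ ∨ IsPGroup 2 ρ.toMonoidHom.range := by
  sorry

/-! ## E0 — frame bridge (S): `IsTorsionGaloisRep` ⟹ BSD's `(Φ, e₀)` frame with `Φ ∘ ρ̄_{E,3} = ρ` -/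

/-- **E0** (S). From the coordinate isomorphism of `IsTorsionGaloisRep` build the frame `(Φ, e₀)` of
`exists_frame_galoisRepTorsion_rat` shape with `Φ (galoisRepTorsion W 3 σ) = ρ σ` — the adapter that lets every BSD brick stated over
`Φ ∘ galoisRepTorsion W p` be instantiated at `p = 3` with the stub's `ρ`. -/
theorem exists_frame_eq (W : WeierstrassCurve ℚ) [W.IsElliptic] (ρ : ModPGaloisRep ℚ (ZMod 3) 2)
    (hρ : W.IsTorsionGaloisRep 3 ρ) :
    ∃ (Φ : Multiplicative (AddAut (geomTorsion W ((3 : ℕ) : ℤ))) ≃* GL (Fin 2) (ZMod 3))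
      (e₀ : geomTorsion W ((3 : ℕ) : ℤ) ≃+ (Fin 2 → ZMod 3)),
      (∀ (g : Multiplicative (AddAut (geomTorsion W ((3 : ℕ) : ℤ)))) (x : geomTorsion W ((3 : ℕ) : ℤ)),
        e₀ (Multiplicative.toAdd g x) = ((Φ g : GL (Fin 2) (ZMod 3)) : Matrix (Fin 2) (Fin 2) (ZMod 3)) *ᵥ e₀ x) ∧
      ∀ σ : absoluteGaloisGroup ℚ, Φ (galoisRepTorsion W ((3 : ℕ) : ℤ) σ) = ρ σ := by
  sorry

/-! ## E1 — the normaliser-of-Cartan datum of a 2-group image (S–M, finite group theory in `GL₂(𝔽₃)` + class field glue) -/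

/-- **E1** (S–M). A `2`-subgroup of `GL₂(𝔽₃)` lies in a `2`-Sylow `= N(C_ns) ≅ SD₁₆`; absolute irreducibility forbids the image to sit
inside the cyclic `C_ns = kˣ` (`k ≅ 𝔽₉ ⊂ M₂(𝔽₃)`), so `U := ρ⁻¹(kˣ)` has index `2`; complex conjugation (`det = χ̄₃(c) = -1`, H0) is not in
`kˣ` (the only involution of `𝔽₉ˣ` is `-1`, of determinant `1`), so `K := ℚ̄^U` is IMAGINARY quadratic; `K/ℚ` is unramified wherever `ρ` is
(inertia `⊆ ker ρ ⊆ U`). = BSD's `smallImage_exists_imaginary_inert_index_two_subgroup_of_goodSS_of_not_surj` + `exists_numberField_of_index_two`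
with the inert clauses DELETED (at `p = 3` the prime `3` may ramify or split in `K`). -/
theorem exists_nsDatum_of_isPGroup_two (W : WeierstrassCurve ℚ) [W.IsElliptic] (ρ : ModPGaloisRep ℚ (ZMod 3) 2)
    (hρ : W.IsTorsionGaloisRep 3 ρ) (habs : FramedRep.IsAbsolutelyIrreducible ρ) (h2 : IsPGroup 2 ρ.toMonoidHom.range) :
    ∃ (k : Subalgebra (ZMod 3) (Matrix (Fin 2) (Fin 2) (ZMod 3))) (K : Type) (_ : Field K) (_ : NumberField K),
      IsField k ∧ Module.finrank (ZMod 3) k = 2 ∧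
      ρ.toMonoidHom.range ≤ Subgroup.normalizer (Serre1972.unitGroup k : Set (GL (Fin 2) (ZMod 3))) ∧
      ((Serre1972.unitGroup k).comap ρ.toMonoidHom).index = 2 ∧
      IsGalois ℚ K ∧ IsTotallyComplex K ∧ Module.finrank ℚ K = 2 ∧
      (absGaloisRestrict ℚ K).toMonoidHom.range = (Serre1972.unitGroup k).comap ρ.toMonoidHom ∧
      (∀ τ : absoluteGaloisGroup K, ρ (absGaloisRestrict ℚ K τ) ∈ Serre1972.unitGroup k) ∧
      (∀ v : HeightOneSpectrum (𝓞 ℚ), ρ.IsUnramifiedAt v → Algebra.IsUnramifiedIn (𝓞 K) v.asIdeal) := by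
  sorry

/-! ## E2 — the Teichmüller twist WITHOUT the inert prime (M; = `exists_isGrossencharakter_congr` with the `p`-clauses deleted) -/

/-- **E2** (M). General Teichmüller twist: `ψ₀` a Grössencharakter mod `𝔪`, `χ` any function with `e`-adic UNIT values off `𝔪`
(so does `ψ₀`), congruent to `ψ₀` on the ray `b ≡ 1 (mod 𝔪)`; then some Grössencharakter `ψ` mod `𝔪` of the same type is congruent
to `χ` off `𝔪`, and `ψ = ψ₀ · u` on principal ideals with `u` a root of unity of order prime to `p`.  Proof = BSD's
`exists_isGrossencharakter_congr` verbatim with the inert-prime fill-in removed: `θ := red (χ/ψ₀)` is a character of the ideals prime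
to `𝔪`, trivial on `P_{𝔪,1}` by `hM`, hence a character of `Cl_𝔪`; twist by its Teichmüller lift.  (The user puts `p` INTO `𝔪`, which is
what makes `hU` satisfiable for type `(1,0)`.) -/
theorem exists_isGrossencharakter_congr_general {K : Type} [Field K] [NumberField K] {p : ℕ} [Fact p.Prime]
    (e : PadicAlgCl p ≃+* ℂ) {𝔪 : Ideal (𝓞 K)} (h𝔪 : 𝔪 ≠ ⊥)
    {pτ qτ : InfinitePlace K → ℤ} {ψ₀ χ : HeightOneSpectrum (𝓞 K) → ℂ}
    (hψ₀ : IsGrossencharakter 𝔪 pτ qτ ψ₀)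
    (hU : ∀ v : HeightOneSpectrum (𝓞 K), ¬ 𝔪 ≤ v.asIdeal → ‖e.symm (χ v)‖ = 1 ∧ ‖e.symm (ψ₀ v)‖ = 1)
    (hM : ∀ b : 𝓞 K, b ≠ 0 → b - 1 ∈ 𝔪 →
      ‖e.symm (idealPow K χ (Ideal.span {b})) - e.symm (idealPow K ψ₀ (Ideal.span {b}))‖ < 1) :
    ∃ ψ : HeightOneSpectrum (𝓞 K) → ℂ,
      IsGrossencharakter 𝔪 pτ qτ ψ ∧
      (∀ v : HeightOneSpectrum (𝓞 K), ¬ 𝔪 ≤ v.asIdeal → ‖e.symm (ψ v) - e.symm (χ v)‖ < 1) ∧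
      (∀ b : 𝓞 K, b ≠ 0 → IsCoprime (Ideal.span {b}) 𝔪 →
        ∃ u : ℂ, (∃ n : ℕ, 0 < n ∧ ¬ p ∣ n ∧ u ^ n = 1) ∧
          idealPow K ψ (Ideal.span {b}) = idealPow K ψ₀ (Ideal.span {b}) * u ∧
          ‖e.symm u * e.symm (idealPow K ψ₀ (Ideal.span {b})) - e.symm (idealPow K χ (Ideal.span {b}))‖ < 1) := by
  sorry

/-! ## E3 — the ARITHMETIC HALF AT 3 (M–L; = BSD `exists_arithmeticHalf_of_inertField` Steps 1–5 re-run with E0/E1/E2, `3 ∈ 𝔪`) -/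

/-- The arithmetic half at `3` of a 2-group-image `ρ ≅ E[3]`: an imaginary quadratic `K`, a modulus `𝔪 ∋ 3`, a weight-2 (type `(1,0)`)
Grössencharakter `ψ` mod `𝔪` with the Γ₀-Nebentypus clause, whose prime sums are `3`-adically congruent to the Frobenius traces of `ρ`
at every prime `q ∤ 3·d_K·N𝔪`, TOGETHER WITH the ramification-transfer clause E4 (for every Hecke character realising `ψ` off `𝔪`:
unramified above `q ∤ 3 d_K` ⟹ `ρ` unramified at `q` with the matching characteristic polynomial) — the clause that survives
primitivisation (`exists_primitive`). -/
def ArithHalfThree (W : WeierstrassCurve ℚ) [W.IsElliptic] (ρ : ModPGaloisRep ℚ (ZMod 3) 2) : Prop :=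
  ∃ (K : Type) (_ : Field K) (_ : NumberField K) (σ : K →+* ℂ) (𝔪 : Ideal (𝓞 K))
    (ψ : HeightOneSpectrum (𝓞 K) → ℂ) (e : PadicAlgCl 3 ≃+* ℂ),
    Module.finrank ℚ K = 2 ∧ IsTotallyComplex K ∧ 𝔪 ≠ ⊥ ∧ 𝔪 ≤ Ideal.span {(3 : 𝓞 K)} ∧
    IsGrossencharakter 𝔪 (embType σ) (embTypeConj σ) ψ ∧
    (∀ n : ℕ, Odd n → n.Coprime ((NumberField.discr K).natAbs * Ideal.absNorm 𝔪) →
      idealPow K ψ (Ideal.span {(n : 𝓞 K)}) = (jacobiSym (NumberField.discr K) n : ℂ) * (n : ℂ) ^ (2 - 1)) ∧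
    (∀ v : HeightOneSpectrum (𝓞 K), ¬ 𝔪 ≤ v.asIdeal → ‖e.symm (ψ v)‖ = 1) ∧
    (∀ (χ : HeckeCharacter K), (∀ v : HeightOneSpectrum (𝓞 K), ¬ 𝔪 ≤ v.asIdeal → χ.valueAtUniformizer v = ψ v) →
      ∀ (q : ℕ) [Fact q.Prime], q ≠ 3 → ¬ (q : ℤ) ∣ NumberField.discr K →
        (∀ w : HeightOneSpectrum (𝓞 K), (q : 𝓞 K) ∈ w.asIdeal → χ.IsUnramifiedAt w) →
        ∀ v : HeightOneSpectrum (𝓞 ℚ), (q : 𝓞 ℚ) ∈ v.asIdeal →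
          ρ.IsUnramifiedAt v ∧
          ∃ a : ZMod 3, ρ.HasFrobCharpolyAt v (X ^ 2 - C a * X + C (q : ZMod 3)) ∧
            ‖e.symm (∑ᶠ (w : HeightOneSpectrum (𝓞 K)) (_ : Ideal.absNorm w.asIdeal = q), χ.valueAtUniformizer w) -
              ((a.val : ℕ) : PadicAlgCl 3)‖ < 1)

/-- **E3** (M–L; the transfer). Steps, each a BSD brick re-instantiated at `p = 3` through E0/E1: (1) `exists_heckeCharacter_teichmuller`
(Teichmüller lift `η` of `Φρ̄|_{G_K} : G_K → kˣ`, conductor-exact `η ↔ χ` ramification clause); (2) crude modulus `𝔪 = (t)`,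
`t = 3^a · B` with `cond η ∣ 𝔪`, `3 𝓞_K ∣ 𝔪`, `d_K ∣ t` (finite-order `η` has a conductor; `le_asIdeal_of_discr_mem`); (3) `exists_unitCharacter`
+ `HeckeThetaPartner.exists_isGrossencharakter_embType` (type-`(1,0)` `ψ₀` mod `𝔪` with `ψ₀((n)) = n·(d_K/n)`); (4) E2 with `χ := η·(unit part)`:
matching on the ray is automatic because `b ≡ 1 (mod 𝔪) ⊇ (mod 3)` forces `red σ(b) = 1`; (5) Nebentypus EXACT with no extra twist
(`η((q)) = Teich(det ρ̄(Frob_q)·…)`, `u_q` of order prime to `3` and `≡ 1` ⟹ `u_q = 1`); (6) trace congruence = `trace (Ind η̄) = η̄ + η̄ᶜ`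
on split primes, `0` on inert ones (`FramedGaloisRep.induce₂` bookkeeping as in BSD `…TraceCongruence`); (7) the E4 clause: coprime local
orders (`ψ = ψ₁ · η`, `ψ₁` of `3`-power order off `3`, `η` of order `∣ 8`) + `artinReciprocity_character_primitive_holds` (ramification `↔`)
+ `q ∤ d_K`. -/
theorem arithHalfThree_of_isPGroup_two (W : WeierstrassCurve ℚ) [W.IsElliptic] (ρ : ModPGaloisRep ℚ (ZMod 3) 2)
    (hρ : W.IsTorsionGaloisRep 3 ρ) (habs : FramedRep.IsAbsolutelyIrreducible ρ) (h2 : IsPGroup 2 ρ.toMonoidHom.range) :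
    ArithHalfThree W ρ := by
  sorry

/-! ## E5 — closing (M, bookkeeping): arithmetic half + Hecke theta + conductor + exact level ⟹ `ρ.IsModular` -/

/-- **E5** (M). `exists_primitive` (conductor `𝔠 ∣ 𝔪`, primitive `ψ'`, `ψ' = ψ` off `𝔪`, `𝔠 ≤ w ↔ w` ramified for every realising Hecke
character) → `nebentypus_of_sharp` (clause for `𝔠`) → `HeckeTheta.heckeThetaCuspForm_of_isGrossencharakter` (`θ_{ψ'} ∈ S₂(Γ₀(d_K·N𝔠))`)
→ residual `shimura1972_heckeTheta_isNewform0_of_primitive` (`θ_{ψ'}` IS a newform of level `d_K·N𝔠`) → `IsModular` with `N := d_K·N𝔠`,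
`w := 2`, `f := liftToGamma1 θ_{ψ'}`, `K := padicAlgClResidueField 3` (discrete), `ι := residue ∘ e.symm` on `coeffCharIntegers f`
(integral elements have `e`-adic norm `≤ 1`), and for `q ∤ 3N`: the E4 clause of `ArithHalfThree` with `χ := heckeOfGross ψ'`
gives unramifiedness and `P := X² − a_q X + q ↦ heckePolynomial f q` (trivial Nebentypus of a lift), `P.map ι = X² − j a X + j q̄`. -/
theorem isModular_of_arithHalfThree (hSh : shimura1972_heckeTheta_isNewform0_of_primitive)
    (W : WeierstrassCurve ℚ) [W.IsElliptic] (ρ : ModPGaloisRep ℚ (ZMod 3) 2)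
    (hρ : W.IsTorsionGaloisRep 3 ρ) (hA : ArithHalfThree W ρ) : ρ.IsModular := by
  sorry

/-! ## Compositions (kernel-checked) -/

/-- ★ PLAN D¹⁰ʙ: the 2-group half of the stub from E3 + E5 and the single residual named fact (kernel-checked). -/
theorem twoGroupBranch_of_shimura (hSh : shimura1972_heckeTheta_isNewform0_of_primitive) : TwoGroupBranch := by
  intro W _ ρ hρ habs h2
  exact isModular_of_arithHalfThree hSh W ρ hρ (arithHalfThree_of_isPGroup_two W ρ hρ habs h2)

/-- The stub is the conjunction of its two halves (kernel-checked modulo H0, N1 — both proved in earlier companions). -/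
theorem stubModThree_of_surj_of_twoGroup (hS : StubModThreeSurj) (hT : TwoGroupBranch) : StubModThree := by
  intro W _ ρ hρ habs
  rcases surjective_or_isPGroup_two ρ habs.isIrreducible (isOdd_of_isTorsionGaloisRep_three W ρ hρ) with hs | h2
  · exact hS W ρ hρ hs
  · exact hT W ρ hρ habs h2

/-- ★★ The stub as typed = (surjective half, blocked-on the LT leaves) + (PLAN D¹⁰ʙ, residual `shimura1972`) (kernel-checked). -/
theorem stubModThree_of_surj_of_shimura (hS : StubModThreeSurj)
    (hSh : shimura1972_heckeTheta_isNewform0_of_primitive) : StubModThree :=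
  stubModThree_of_surj_of_twoGroup hS (twoGroupBranch_of_shimura hSh)

/-- Sanity: `StubModThree` is literally the registered stub's statement (the skeleton's `stub_modThree`). -/
example (h : StubModThree) : ∀ (W : WeierstrassCurve ℚ) [W.IsElliptic] (ρ : ModPGaloisRep ℚ (ZMod 3) 2),
    W.IsTorsionGaloisRep 3 ρ → FramedRep.IsAbsolutelyIrreducible ρ → ρ.IsModular := h

end Summit.ABC.ABC.Cruxes.FreyModularity.Sketch.StubModThreeIdeasK1G10
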